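import Summits.QuantumFields.YangMills.Theorems.UnitScaleTiltProp7ZeroModesOrthKerTopMean
import Summits.QuantumFields.YangMills.Theorems.UnitScaleTiltProp7RieszTauFrobNormT3
import HarnessLib

/-!
# Route `UnitScaleTilt`, crux K1 «MinimiserStabilityRegPr» (stmt-QuantumFields-19200), EX face row `norm_G`, N6 FILE C letters — **THE (c)-PACKAGE: THE FOUR
# `L^∞ → L^∞` LETTERS (c1) `‖R_S‖`, (c2) `‖G′ᴾR_S‖`, (c3) `‖D G′ᴾR_S‖`, (c4) `‖R_S G′ᴾ‖` OF THE GAUGE-RESTORING WORDS, FROM P4's THREE sup→sup LETTERS AND (Z0)**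
# (★p1 g27 CHAIR WORD №28 «file B … + the (c)-package … over ✓`hT1_of_regPr`∕✓`hGsup_of_regPr`∕P1∕P4»; width seat `ym3-torus-px5` gen 13)

Cell `ym3-torus` (HUMAN RULING D-0037; rung R3 = SU(2) YM₃ on T³ — NOT d = 4, NOT infinite volume, NOT a mass gap, NOT Clay).  THEOREMS ONLY (0 `def`, 0 `sorry`, default heartbeats);
`--supports stmt-QuantumFields-19200 --as helper`; count-neutral.

THE POINT.  The chair's N6 knit (FILE C, the `(sup, sup∘D*)` bootstrap for `G_π = G₀(1 − Δ′G₀)⁻¹`) displays four operator letters for print's gauge-restoring words on bounded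
sources: `R_S`, `G′ᴾR_S`, `D_{U₀}G′ᴾR_S`, `R_SG′ᴾ : L^∞ → L^∞`.  All four are ONE LINE each over P4 ✓`Prop7PcolOfGradientRow`'s three sup→sup letters — `hsrc` (`‖T c(v)‖_∞ ≤ C_src‖v‖_∞`,
the Gram source of `1 − projR`, P3v), `hGsup` (`‖G_a f‖_∞ ≤ B_∞‖f‖_∞`), `hT1` (`‖D_{U₀}G_a f‖_∞ ≤ R₁‖f‖_∞`) — the source form `(1 − projR)v = G_a(T c(v))` (`hsrcid`, P3v
✓`sub_projR_eq_G_lift_coeffSum`), `R_S = projR` under Lift (`hRS`), and (Z0) ✓`Prop7ZeroModesOrthKerTopMean` (`G′ᴾR_S = G_aR_S`, `R_SG′ᴾ = R_SG_a`: NO `P₀`, so P4's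
`g′ = (1 − P₀)g` factor `5` disappears): `R_S = 1 − G_aTc(·)`, `G′ᴾR_S = G_aR_S`, `DG′ᴾR_S = DG_aR_S`, `R_SG′ᴾ = R_SG_a = G_a(1 − Tc G_a)`.
WHAT IS PROVED (ns `Summit.QuantumFields.YangMills.Theorems.Prop7GaugeProjectorSupPackage`; P4's LOD∕Lift letters `Q″ hseq ι T hT G hAG hGA hRS hker` and the three sup letters DISPLAYED
VERBATIM as in ✓`gradient_row_of_letters`; pointwise `WL2.equiv` currency of P4a∕V6; `G′ᴾ`'s parameter `0 ≤ a′` free of the LOD mass `a`):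
* §1 `RS_eq_sub_of_sourceForm` (`R_S v = v − G_a(T(c v))`), ★(c1) `norm_equiv_RS_le_of_letters` (`‖(R_S g)(y)‖ ≤ (1 + B_∞C_src)·Gb`),
  ★(c2) `norm_equiv_GprimeP_RS_le_of_letters` (`‖(G′ᴾ_{a′}R_S g)(y)‖ ≤ B_∞(1 + B_∞C_src)·Gb`), ★(c3) `norm_equiv_DL2_GprimeP_RS_le_of_letters` (`‖(D G′ᴾ_{a′}R_S g)(p)‖ ≤ R₁(1 + B_∞C_src)·Gb`),
  `norm_equiv_sub_source_le` (`‖(g − Tc(G_ag))(y)‖ ≤ (1 + C_srcB_∞)Gb`), ★(c4) `norm_equiv_RS_GprimeP_le_of_letters` (`‖(R_S G′ᴾ_{a′} g)(y)‖ ≤ B_∞(1 + C_srcB_∞)·Gb`),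
  ★(c3′) `gradient_row_of_letters'` (`‖(D R_S G′ᴾ_{a′} g)(p)‖ ≤ R₁(1 + C_srcB_∞)·Gb` — P4 :187 with `5 ↦ 1`), ★`hPcol_of_letters'` (hPcol's display with `p139 := 4√2·R₁(1 + C_srcB_∞)`, P4a).
* §2 the ROUTE-currency readings (★p1 g27's FILE C display, `‖v x‖ ≤ m` ⟹ outputs through `toL2S⁻¹`∕`toL2⁻¹`): `norm_equiv_toL2S_le_sqrt_two_mul` (dictionary, `√2`),
  ★(c1ʳ) `norm_symm_GprimeP_RS_toL2S_le_of_letters` (`√2·B_∞(1 + B_∞C_src)·m`), ★(c2ʳ) `norm_symm_DL2_GprimeP_RS_toL2S_le_of_letters` (`√2·R₁(1 + B_∞C_src)·m`),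
  ★(c3ʳ) `norm_symm_RS_GprimeP_toL2S_le_of_letters` (`√2·B_∞(1 + C_srcB_∞)·m`).
HYP-SAT (★★OWNER RULING №42).  Letters exactly P4's (inhabited there and in PIN-A ✓`Prop7PcolPin`: `hT1`∕`hGsup`∕`hsrc` are real-inequality schemas with K-free constants; `hseq hT hAG hGA`
⟸ ✓`exists_massive_inverse`∕✓`exists_intertwiner_of_regPr`; `hRS hker` ⟸ ✓`RS_eq_projR_of_lift` under the Lift antecedent; `hsrcid` ⟸ P3v).  Conclusions are sup bounds of the
row's own objects; no `Prop` placeholder.  The PINNED (K-free closed constants) and MEMBER-OF-RECORD editions follow in `…SupPackagePin`∕`…SupPackageMember`.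
HONEST SCOPE.  Bookkeeping over landed letters; CONDITIONAL on the three displayed sup letters; nothing of N6's knit, `norm_G`, the ten EX rows, EX or the crux is proved here;
the Yang–Mills mass gap is NOT proved.

References: T. Bałaban, CMP **99** (1985) 389–434 [Balaban1985BackgroundPropagators] ((3.20)–(3.25) p.394, Thm 3.1 (3.42)∕(3.46) pp.397–398, (3.49) p.399, (3.118)–(3.122)
pp.419–420); CMP **102** (1985) 277–309 [Balaban1985Variational] ((138)–(139) p.299 «`G′RD*` is a bounded operator»).
-/

set_option autoImplicit false

noncomputable section

open scoped BigOperators Matrix.Norms.L2Operator InnerProductSpace ComplexConjugate Matrix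

namespace Summit.QuantumFields.YangMills.Theorems.Prop7GaugeProjectorSupPackage

open Literature.MathematicalPhysics.QuantumFieldTheory.Balaban1983to89
open Literature.MathematicalPhysics.QuantumFieldTheory.Balaban1983to89.T3ContinuumYM3Torus
open T4Continuum BlockAveraging
open BlockAveraging (Idx off)
open B7Prop1Explicit (disp)
open B10Eq27TorusAxialLog (holT transl)
open B7TransferAnalyticMean (meanCLM)
open B4Sect5Torus (TSite)
open B9SectCLatticeCarrier (Bond)
open B9Eq311L2Pairing (WL2)
open B11Eq103H1Complex (SiteL2K BondL2K projR)
open Summit.QuantumFields.YangMills.Theorems.Prop8Chart (emlIterU)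
open T3SectALandauChart (eta bgUnits)
open Summit.QuantumFields.YangMills.Theorems.Prop7SectET3Transport (periodsT3 siteEquiv bondEquiv)
open Summit.QuantumFields.YangMills.Theorems.Prop7SectET3HilbertLetters (W₂ frobEquiv toL2 toL2S DL2 DstarL2 covLapSite toL2S_apply toL2S_symm_apply toL2_symm_apply)
open Summit.QuantumFields.YangMills.Theorems.Prop7RieszTauFrobNorm (norm_frobEquiv_symm_le norm_frobEquiv_le)
open Summit.QuantumFields.YangMills.Theorems.Prop7SectET3GaugeProjector (NS RS)
open Summit.QuantumFields.YangMills.Theorems.Prop7SectET3DeltaPiPInv (kerDProj GprimeP)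
open Summit.QuantumFields.YangMills.Theorems.Prop7KernelColumnRowDuality (sum_norm_GprimeP_RS_DstarL2_single_le_of_gradient_row)
open Summit.QuantumFields.YangMills.Theorems.Prop7PcolOfGradientRow (RS_G_eq_of_sourceForm)
open Summit.QuantumFields.YangMills.Theorems.Prop7ZeroModesOrthKerTopMean (GprimeP_RS_eq_G_RS RS_GprimeP_eq_RS_G)

variable (F : T3Family) {n K : ℕ} (h : n ≤ K) {c₀ c₁ cB : ℝ} [Fact (0 < c₀)] [Fact (0 < c₁)] [Fact (0 < cB)]
  (U₀ : GaugeField (F.P K) 0 (Matrix.specialUnitaryGroup (Fin 2) ℂ))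
  (Q'' : SiteL2K ℂ 3 (periodsT3 F K) c₀ W₂ →ₗ[ℂ] (Site (F.P K) (K - n) → Matrix (Fin 2) (Fin 2) ℂ))
  (hseq : ∀ lam : Site (F.P K) 0 → Matrix (Fin 2) (Fin 2) ℂ, ∃ ns : (j : ℕ) → Site (F.P K) j → Matrix (Fin 2) (Fin 2) ℂ, ns 0 = lam ∧
      (∀ (j : ℕ) (y : Site (F.P K) (j + 1)), ns (j + 1) y = ns j (emb y) - meanCLM (Idx (F.P K)) (Matrix (Fin 2) (Fin 2) ℂ) fun i : Idx (F.P K) =>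
        ns j (emb y) - ((holT (emlIterU j (bgUnits F K U₀)) (emb y) (stairWord i.2.1 (off i.1)) : (Matrix (Fin 2) (Fin 2) ℂ)ˣ) : Matrix (Fin 2) (Fin 2) ℂ) *
          ns j (transl (emb y) (disp (stairWord i.2.1 (off i.1)))) * (((holT (emlIterU j (bgUnits F K U₀)) (emb y) (stairWord i.2.1 (off i.1)))⁻¹ : (Matrix (Fin 2) (Fin 2) ℂ)ˣ) : Matrix (Fin 2) (Fin 2) ℂ)) ∧
      ns (K - n) = Q'' (toL2S F K c₀ lam))
  (ι : (Site (F.P K) (K - n) → Matrix (Fin 2) (Fin 2) ℂ) →ₗ[ℂ] SiteL2K ℂ 3 (periodsT3 F n) c₁ W₂)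
  (T : SiteL2K ℂ 3 (periodsT3 F n) c₁ W₂ →ₗ[ℂ] SiteL2K ℂ 3 (periodsT3 F K) c₀ W₂)
  (hT : ∀ (l : SiteL2K ℂ 3 (periodsT3 F K) c₀ W₂) (f : SiteL2K ℂ 3 (periodsT3 F n) c₁ W₂), ⟪ι (Q'' l), f⟫_ℂ = ⟪l, T f⟫_ℂ)
  {a : ℝ}
  (G : SiteL2K ℂ 3 (periodsT3 F K) c₀ W₂ →ₗ[ℂ] SiteL2K ℂ 3 (periodsT3 F K) c₀ W₂)
  (hAG : ∀ f, covLapSite F n K c₀ U₀ (G f) + (a : ℂ) • T (ι (Q'' (G f))) = f)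
  (hGA : ∀ u, G (covLapSite F n K c₀ U₀ u + (a : ℂ) • T (ι (Q'' u))) = u)
  (hRS : RS F n K h c₀ cB U₀ = projR (covLapSite F n K c₀ U₀) Q'')
  (hker : LinearMap.ker Q'' ≤ NS F n K h c₀ cB U₀)

/-! ## §1 The four letters -/

include hRS in
omit [Fact (0 < c₁)] [Fact (0 < cB)] in
/-- **`R_S v = v − G_a(T(c v))`** under Lift (`R_S = projR`) and the source form `(1 − projR)v = G_a(T(c v))`. [cite: Balaban1985BackgroundPropagators, (3.21) p.394, (3.49) p.399] -/
theorem RS_eq_sub_of_sourceForm (c : SiteL2K ℂ 3 (periodsT3 F K) c₀ W₂ → SiteL2K ℂ 3 (periodsT3 F n) c₁ W₂)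
    (hsrcid : ∀ v, v - projR (covLapSite F n K c₀ U₀) Q'' v = G (T (c v))) (v : SiteL2K ℂ 3 (periodsT3 F K) c₀ W₂) :
    RS F n K h c₀ cB U₀ v = v - G (T (c v)) := by
  rw [hRS, ← hsrcid v, sub_sub_cancel]

include hRS in
omit [Fact (0 < c₁)] [Fact (0 < cB)] in
/-- ★ **(c1) `‖R_S‖_{∞→∞} ≤ 1 + B_∞C_src`**: `‖(R_S g)(y)‖ ≤ (1 + B_∞·C_src)·Gb` whenever `‖g(y)‖ ≤ Gb` for all `y` (`R_S = 1 − G_aTc(·)`, the VALUE and source letters).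
[cite: Balaban1985BackgroundPropagators, (3.21) p.394, Thm 3.1 (3.46) p.398] -/
theorem norm_equiv_RS_le_of_letters (c : SiteL2K ℂ 3 (periodsT3 F K) c₀ W₂ → SiteL2K ℂ 3 (periodsT3 F n) c₁ W₂)
    (hsrcid : ∀ v, v - projR (covLapSite F n K c₀ U₀) Q'' v = G (T (c v)))
    {Csrc : ℝ} (hsrc : ∀ (v : SiteL2K ℂ 3 (periodsT3 F K) c₀ W₂) (Vb : ℝ), (∀ y, ‖WL2.equiv ℂ _ W₂ v y‖ ≤ Vb) → ∀ y, ‖WL2.equiv ℂ _ W₂ (T (c v)) y‖ ≤ Csrc * Vb)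
    {Bv : ℝ} (hGsup : ∀ (f : SiteL2K ℂ 3 (periodsT3 F K) c₀ W₂) (Fb : ℝ), (∀ y, ‖WL2.equiv ℂ _ W₂ f y‖ ≤ Fb) → ∀ y, ‖WL2.equiv ℂ _ W₂ (G f) y‖ ≤ Bv * Fb)
    (g : SiteL2K ℂ 3 (periodsT3 F K) c₀ W₂) (Gb : ℝ) (hg : ∀ y, ‖WL2.equiv ℂ _ W₂ g y‖ ≤ Gb) (y : TSite 3 (periodsT3 F K)) :
    ‖WL2.equiv ℂ _ W₂ (RS F n K h c₀ cB U₀ g) y‖ ≤ (1 + Bv * Csrc) * Gb := by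
  have hG := hGsup _ _ (hsrc _ _ hg)
  rw [RS_eq_sub_of_sourceForm F h U₀ Q'' T G hRS c hsrcid g, WL2.equiv_sub, Pi.sub_apply]
  calc ‖WL2.equiv ℂ _ W₂ g y - WL2.equiv ℂ _ W₂ (G (T (c g))) y‖ ≤ Gb + Bv * (Csrc * Gb) := (norm_sub_le _ _).trans (add_le_add (hg y) (hG y))
    _ = (1 + Bv * Csrc) * Gb := by ring

include hseq hGA hRS hker in
omit [Fact (0 < c₁)] in
/-- ★ **(c2) `‖G′ᴾ_{a′}R_S‖_{∞→∞} ≤ B_∞(1 + B_∞C_src)`**: `‖(G′ᴾ_{a′}(R_S g))(y)‖ ≤ B_∞·(1 + B_∞·C_src)·Gb` — (Z0) ✓`GprimeP_RS_eq_G_RS` (`G′ᴾR_S = G_aR_S`, no `P₀`), the VALUE letter, (c1).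
[cite: Balaban1985BackgroundPropagators, (3.25) p.394, Thm 3.1 (3.42)∕(3.46) pp.397–398, (3.118)–(3.122) pp.419–420] -/
theorem norm_equiv_GprimeP_RS_le_of_letters {a' : ℝ} (ha' : 0 ≤ a') (c : SiteL2K ℂ 3 (periodsT3 F K) c₀ W₂ → SiteL2K ℂ 3 (periodsT3 F n) c₁ W₂)
    (hsrcid : ∀ v, v - projR (covLapSite F n K c₀ U₀) Q'' v = G (T (c v)))
    {Csrc : ℝ} (hsrc : ∀ (v : SiteL2K ℂ 3 (periodsT3 F K) c₀ W₂) (Vb : ℝ), (∀ y, ‖WL2.equiv ℂ _ W₂ v y‖ ≤ Vb) → ∀ y, ‖WL2.equiv ℂ _ W₂ (T (c v)) y‖ ≤ Csrc * Vb)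
    {Bv : ℝ} (hGsup : ∀ (f : SiteL2K ℂ 3 (periodsT3 F K) c₀ W₂) (Fb : ℝ), (∀ y, ‖WL2.equiv ℂ _ W₂ f y‖ ≤ Fb) → ∀ y, ‖WL2.equiv ℂ _ W₂ (G f) y‖ ≤ Bv * Fb)
    (g : SiteL2K ℂ 3 (periodsT3 F K) c₀ W₂) (Gb : ℝ) (hg : ∀ y, ‖WL2.equiv ℂ _ W₂ g y‖ ≤ Gb) (y : TSite 3 (periodsT3 F K)) :
    ‖WL2.equiv ℂ _ W₂ (GprimeP F n K h c₀ cB a' U₀ (RS F n K h c₀ cB U₀ g)) y‖ ≤ Bv * (1 + Bv * Csrc) * Gb := by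
  rw [GprimeP_RS_eq_G_RS F h U₀ Q'' hseq ι T G hGA hRS hker ha' g]
  calc ‖WL2.equiv ℂ _ W₂ (G (RS F n K h c₀ cB U₀ g)) y‖ ≤ Bv * ((1 + Bv * Csrc) * Gb) :=
        hGsup _ _ (fun y => norm_equiv_RS_le_of_letters F h U₀ Q'' T G hRS c hsrcid hsrc hGsup g Gb hg y) y
    _ = Bv * (1 + Bv * Csrc) * Gb := by ring

include hseq hGA hRS hker in
omit [Fact (0 < c₁)] in
/-- ★ **(c3) `‖D_{U₀}G′ᴾ_{a′}R_S‖_{∞→∞} ≤ R₁(1 + B_∞C_src)`** (pointwise on bonds): (Z0), the GRADIENT letter T1, (c1).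
[cite: Balaban1985BackgroundPropagators, (3.25) p.394, Thm 3.1 (3.42) p.397; Balaban1985Variational, (139) p.299] -/
theorem norm_equiv_DL2_GprimeP_RS_le_of_letters {a' : ℝ} (ha' : 0 ≤ a') (c : SiteL2K ℂ 3 (periodsT3 F K) c₀ W₂ → SiteL2K ℂ 3 (periodsT3 F n) c₁ W₂)
    (hsrcid : ∀ v, v - projR (covLapSite F n K c₀ U₀) Q'' v = G (T (c v)))
    {Csrc : ℝ} (hsrc : ∀ (v : SiteL2K ℂ 3 (periodsT3 F K) c₀ W₂) (Vb : ℝ), (∀ y, ‖WL2.equiv ℂ _ W₂ v y‖ ≤ Vb) → ∀ y, ‖WL2.equiv ℂ _ W₂ (T (c v)) y‖ ≤ Csrc * Vb)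
    {Bv : ℝ} (hGsup : ∀ (f : SiteL2K ℂ 3 (periodsT3 F K) c₀ W₂) (Fb : ℝ), (∀ y, ‖WL2.equiv ℂ _ W₂ f y‖ ≤ Fb) → ∀ y, ‖WL2.equiv ℂ _ W₂ (G f) y‖ ≤ Bv * Fb)
    {R₁ : ℝ} (hT1 : ∀ (f : SiteL2K ℂ 3 (periodsT3 F K) c₀ W₂) (Fb : ℝ), (∀ y, ‖WL2.equiv ℂ _ W₂ f y‖ ≤ Fb) →
      ∀ p : Bond 3 (periodsT3 F K), ‖WL2.equiv ℂ _ W₂ (DL2 F n K c₀ U₀ (G f)) p‖ ≤ R₁ * Fb)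
    (g : SiteL2K ℂ 3 (periodsT3 F K) c₀ W₂) (Gb : ℝ) (hg : ∀ y, ‖WL2.equiv ℂ _ W₂ g y‖ ≤ Gb) (p : Bond 3 (periodsT3 F K)) :
    ‖WL2.equiv ℂ _ W₂ (DL2 F n K c₀ U₀ (GprimeP F n K h c₀ cB a' U₀ (RS F n K h c₀ cB U₀ g))) p‖ ≤ R₁ * (1 + Bv * Csrc) * Gb := by
  rw [GprimeP_RS_eq_G_RS F h U₀ Q'' hseq ι T G hGA hRS hker ha' g]
  calc ‖WL2.equiv ℂ _ W₂ (DL2 F n K c₀ U₀ (G (RS F n K h c₀ cB U₀ g))) p‖ ≤ R₁ * ((1 + Bv * Csrc) * Gb) :=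
        hT1 _ _ (fun y => norm_equiv_RS_le_of_letters F h U₀ Q'' T G hRS c hsrcid hsrc hGsup g Gb hg y) p
    _ = R₁ * (1 + Bv * Csrc) * Gb := by ring

omit [Fact (0 < c₀)] [Fact (0 < c₁)] [Fact (0 < cB)] in
/-- The source bookkeeping WITHOUT `P₀`: `‖(g − T(c(G_a g)))(y)‖ ≤ (1 + C_src·B_∞)·Gb` (P4 ✓`norm_equiv_source_le` had `5Gb` from `g′ = (1 − P₀)g`; (Z0) removes it).
[cite: Balaban1985BackgroundPropagators, (3.24)–(3.25) p.394] -/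
theorem norm_equiv_sub_source_le (c : SiteL2K ℂ 3 (periodsT3 F K) c₀ W₂ → SiteL2K ℂ 3 (periodsT3 F n) c₁ W₂)
    {Csrc : ℝ} (hsrc : ∀ (v : SiteL2K ℂ 3 (periodsT3 F K) c₀ W₂) (Vb : ℝ), (∀ y, ‖WL2.equiv ℂ _ W₂ v y‖ ≤ Vb) → ∀ y, ‖WL2.equiv ℂ _ W₂ (T (c v)) y‖ ≤ Csrc * Vb)
    {Bv : ℝ} (hGsup : ∀ (f : SiteL2K ℂ 3 (periodsT3 F K) c₀ W₂) (Fb : ℝ), (∀ y, ‖WL2.equiv ℂ _ W₂ f y‖ ≤ Fb) → ∀ y, ‖WL2.equiv ℂ _ W₂ (G f) y‖ ≤ Bv * Fb)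
    (g : SiteL2K ℂ 3 (periodsT3 F K) c₀ W₂) (Gb : ℝ) (hg : ∀ y, ‖WL2.equiv ℂ _ W₂ g y‖ ≤ Gb) (y : TSite 3 (periodsT3 F K)) :
    ‖WL2.equiv ℂ _ W₂ (g - T (c (G g))) y‖ ≤ (1 + Csrc * Bv) * Gb := by
  have hTc := hsrc _ _ (hGsup _ _ hg)
  rw [WL2.equiv_sub, Pi.sub_apply]
  calc ‖WL2.equiv ℂ _ W₂ g y - WL2.equiv ℂ _ W₂ (T (c (G g))) y‖ ≤ Gb + Csrc * (Bv * Gb) := (norm_sub_le _ _).trans (add_le_add (hg y) (hTc y))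
    _ = (1 + Csrc * Bv) * Gb := by ring

include hseq hT hAG hGA hRS hker in
/-- ★ **(c4) `‖R_S G′ᴾ_{a′}‖_{∞→∞} ≤ B_∞(1 + C_srcB_∞)`**: `‖(R_S(G′ᴾ_{a′} g))(y)‖ ≤ B_∞·(1 + C_src·B_∞)·Gb` — (Z0) ✓`RS_GprimeP_eq_RS_G` (`R_SG′ᴾ = R_SG_a`), P4 ✓`RS_G_eq_of_sourceForm`
(`R_S(G_a g) = G_a(g − Tc(G_a g))`), the VALUE letter. [cite: Balaban1985BackgroundPropagators, (3.21)–(3.25) p.394, Thm 3.1 (3.46) p.398] -/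
theorem norm_equiv_RS_GprimeP_le_of_letters {a' : ℝ} (ha' : 0 ≤ a') (c : SiteL2K ℂ 3 (periodsT3 F K) c₀ W₂ → SiteL2K ℂ 3 (periodsT3 F n) c₁ W₂)
    (hsrcid : ∀ v, v - projR (covLapSite F n K c₀ U₀) Q'' v = G (T (c v)))
    {Csrc : ℝ} (hsrc : ∀ (v : SiteL2K ℂ 3 (periodsT3 F K) c₀ W₂) (Vb : ℝ), (∀ y, ‖WL2.equiv ℂ _ W₂ v y‖ ≤ Vb) → ∀ y, ‖WL2.equiv ℂ _ W₂ (T (c v)) y‖ ≤ Csrc * Vb)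
    {Bv : ℝ} (hGsup : ∀ (f : SiteL2K ℂ 3 (periodsT3 F K) c₀ W₂) (Fb : ℝ), (∀ y, ‖WL2.equiv ℂ _ W₂ f y‖ ≤ Fb) → ∀ y, ‖WL2.equiv ℂ _ W₂ (G f) y‖ ≤ Bv * Fb)
    (g : SiteL2K ℂ 3 (periodsT3 F K) c₀ W₂) (Gb : ℝ) (hg : ∀ y, ‖WL2.equiv ℂ _ W₂ g y‖ ≤ Gb) (y : TSite 3 (periodsT3 F K)) :
    ‖WL2.equiv ℂ _ W₂ (RS F n K h c₀ cB U₀ (GprimeP F n K h c₀ cB a' U₀ g)) y‖ ≤ Bv * (1 + Csrc * Bv) * Gb := by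
  rw [RS_GprimeP_eq_RS_G F h U₀ Q'' hseq ι T hT G hAG hGA hRS hker ha' g, RS_G_eq_of_sourceForm F h U₀ Q'' T G hRS c hsrcid g]
  calc ‖WL2.equiv ℂ _ W₂ (G (g - T (c (G g)))) y‖ ≤ Bv * ((1 + Csrc * Bv) * Gb) :=
        hGsup _ _ (fun y => norm_equiv_sub_source_le F T G c hsrc hGsup g Gb hg y) y
    _ = Bv * (1 + Csrc * Bv) * Gb := by ring

include hseq hT hAG hGA hRS hker in
/-- ★ **(c3′) P4's GRADIENT ROW WITHOUT THE FACTOR 5**: `‖(D_{U₀}(R_S(G′ᴾ_{a′} g)))(p)‖ ≤ R₁·(1 + C_src·B_∞)·Gb` — ✓`gradient_row_of_letters` :187 with `g′ = (1 − P₀)g ↦ g` by (Z0).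
[cite: Balaban1985Variational, (138)–(139) p.299; Balaban1985BackgroundPropagators, Thm 3.1 (3.42) p.397] -/
theorem gradient_row_of_letters' {a' : ℝ} (ha' : 0 ≤ a') (c : SiteL2K ℂ 3 (periodsT3 F K) c₀ W₂ → SiteL2K ℂ 3 (periodsT3 F n) c₁ W₂)
    (hsrcid : ∀ v, v - projR (covLapSite F n K c₀ U₀) Q'' v = G (T (c v)))
    {Csrc : ℝ} (hsrc : ∀ (v : SiteL2K ℂ 3 (periodsT3 F K) c₀ W₂) (Vb : ℝ), (∀ y, ‖WL2.equiv ℂ _ W₂ v y‖ ≤ Vb) → ∀ y, ‖WL2.equiv ℂ _ W₂ (T (c v)) y‖ ≤ Csrc * Vb)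
    {Bv : ℝ} (hGsup : ∀ (f : SiteL2K ℂ 3 (periodsT3 F K) c₀ W₂) (Fb : ℝ), (∀ y, ‖WL2.equiv ℂ _ W₂ f y‖ ≤ Fb) → ∀ y, ‖WL2.equiv ℂ _ W₂ (G f) y‖ ≤ Bv * Fb)
    {R₁ : ℝ} (hT1 : ∀ (f : SiteL2K ℂ 3 (periodsT3 F K) c₀ W₂) (Fb : ℝ), (∀ y, ‖WL2.equiv ℂ _ W₂ f y‖ ≤ Fb) →
      ∀ p : Bond 3 (periodsT3 F K), ‖WL2.equiv ℂ _ W₂ (DL2 F n K c₀ U₀ (G f)) p‖ ≤ R₁ * Fb)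
    (g : SiteL2K ℂ 3 (periodsT3 F K) c₀ W₂) (Gb : ℝ) (hg : ∀ y, ‖WL2.equiv ℂ _ W₂ g y‖ ≤ Gb) (p : Bond 3 (periodsT3 F K)) :
    ‖WL2.equiv ℂ _ W₂ (DL2 F n K c₀ U₀ (RS F n K h c₀ cB U₀ (GprimeP F n K h c₀ cB a' U₀ g))) p‖ ≤ R₁ * (1 + Csrc * Bv) * Gb := by
  rw [RS_GprimeP_eq_RS_G F h U₀ Q'' hseq ι T hT G hAG hGA hRS hker ha' g, RS_G_eq_of_sourceForm F h U₀ Q'' T G hRS c hsrcid g]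
  calc ‖WL2.equiv ℂ _ W₂ (DL2 F n K c₀ U₀ (G (g - T (c (G g))))) p‖ ≤ R₁ * ((1 + Csrc * Bv) * Gb) :=
        hT1 _ _ (fun y => norm_equiv_sub_source_le F T G c hsrc hGsup g Gb hg y) p
    _ = R₁ * (1 + Csrc * Bv) * Gb := by ring

include hseq hT hAG hGA hRS hker in
/-- ★ **hPcol's DISPLAY WITH `p139 := 4√2·R₁(1 + C_srcB_∞)`** (P4a ✓`sum_norm_GprimeP_RS_DstarL2_single_le_of_gradient_row` on (c3′); P4 ✓`hPcol_of_letters` had `20√2·R₁(1 + C_srcB_∞)`).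
[cite: Balaban1985Variational, (139) p.299; Balaban1985BackgroundPropagators, Thm 3.1 (3.42) p.397] -/
theorem hPcol_of_letters' {a' : ℝ} (ha' : 0 ≤ a') (c : SiteL2K ℂ 3 (periodsT3 F K) c₀ W₂ → SiteL2K ℂ 3 (periodsT3 F n) c₁ W₂)
    (hsrcid : ∀ v, v - projR (covLapSite F n K c₀ U₀) Q'' v = G (T (c v)))
    {Csrc : ℝ} (hsrc : ∀ (v : SiteL2K ℂ 3 (periodsT3 F K) c₀ W₂) (Vb : ℝ), (∀ y, ‖WL2.equiv ℂ _ W₂ v y‖ ≤ Vb) → ∀ y, ‖WL2.equiv ℂ _ W₂ (T (c v)) y‖ ≤ Csrc * Vb)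
    {Bv : ℝ} (hGsup : ∀ (f : SiteL2K ℂ 3 (periodsT3 F K) c₀ W₂) (Fb : ℝ), (∀ y, ‖WL2.equiv ℂ _ W₂ f y‖ ≤ Fb) → ∀ y, ‖WL2.equiv ℂ _ W₂ (G f) y‖ ≤ Bv * Fb)
    {R₁ : ℝ} (hT1 : ∀ (f : SiteL2K ℂ 3 (periodsT3 F K) c₀ W₂) (Fb : ℝ), (∀ y, ‖WL2.equiv ℂ _ W₂ f y‖ ≤ Fb) →
      ∀ p : Bond 3 (periodsT3 F K), ‖WL2.equiv ℂ _ W₂ (DL2 F n K c₀ U₀ (G f)) p‖ ≤ R₁ * Fb)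
    (bd : PBond (F.P K) 0) (E : Matrix (Fin 2) (Fin 2) ℂ) :
    ∑ x : Site (F.P K) 0, ‖(toL2S F K c₀).symm (GprimeP F n K h c₀ cB a' U₀ (RS F n K h c₀ cB U₀ (DstarL2 F n K c₀ U₀ (toL2 F K c₀ (Pi.single bd E))))) x‖
      ≤ 4 * Real.sqrt 2 * (R₁ * (1 + Csrc * Bv)) * ‖E‖ :=
  sum_norm_GprimeP_RS_DstarL2_single_le_of_gradient_row F c₀ h cB a' ha' U₀
    (fun g Gb hg p => gradient_row_of_letters' F h U₀ Q'' hseq ι T hT G hAG hGA hRS hker ha' c hsrcid hsrc hGsup hT1 g Gb hg p) bd E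

/-! ## §2 The three operator letters in the ROUTE currency (★p1 g27's FILE C display): `‖v x‖ ≤ m` on `Site (F.P K) 0 → M₂(ℂ)`, outputs through `toL2S⁻¹`∕`toL2⁻¹`
(dictionary: Frobenius vs operator norm, ✓`norm_frobEquiv_symm_le` (`√2`) and ✓`norm_frobEquiv_le` (`1`); so FILE C's `C₁ = √2·B_∞(1 + B_∞C_src)`, `C₂ = √2·R₁(1 + B_∞C_src)`,
`C₃ = √2·B_∞(1 + C_srcB_∞)`) -/

omit [Fact (0 < c₀)] [Fact (0 < c₁)] [Fact (0 < cB)] in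
/-- Dictionary: `‖v x‖ ≤ m` for all `x` ⟹ `‖(toL2S v)(y)‖_{W₂} ≤ √2·m` (the fibre of `toL2S` is `frobEquiv⁻¹`; Frobenius ≤ √2 · operator norm on `M₂(ℂ)`).
[cite: Balaban1985BackgroundPropagators, (3.11) p.392] -/
theorem norm_equiv_toL2S_le_sqrt_two_mul (v : Site (F.P K) 0 → Matrix (Fin 2) (Fin 2) ℂ) {m : ℝ} (hv : ∀ x, ‖v x‖ ≤ m)
    (y : TSite 3 (periodsT3 F K)) : ‖WL2.equiv ℂ _ W₂ (toL2S F K c₀ v) y‖ ≤ Real.sqrt 2 * m := by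
  rw [toL2S_apply]
  exact (norm_frobEquiv_symm_le _).trans (mul_le_mul_of_nonneg_left (hv _) (Real.sqrt_nonneg _))

include hseq hGA hRS hker in
omit [Fact (0 < c₁)] in
/-- ★ **(c1ʳ) = FILE C's (c1): `‖toL2S⁻¹(G′ᴾ_{a′}(R_S(toL2S v))) x‖ ≤ √2·B_∞(1 + B_∞C_src)·m`** whenever `‖v x‖ ≤ m` for all `x` ((c2) read through the dictionary).
[cite: Balaban1985BackgroundPropagators, (3.21)–(3.25) p.394, Thm 3.1 (3.42)∕(3.46) pp.397–398; Balaban1985Variational, (139) p.299] -/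
theorem norm_symm_GprimeP_RS_toL2S_le_of_letters {a' : ℝ} (ha' : 0 ≤ a') (c : SiteL2K ℂ 3 (periodsT3 F K) c₀ W₂ → SiteL2K ℂ 3 (periodsT3 F n) c₁ W₂)
    (hsrcid : ∀ v, v - projR (covLapSite F n K c₀ U₀) Q'' v = G (T (c v)))
    {Csrc : ℝ} (hsrc : ∀ (v : SiteL2K ℂ 3 (periodsT3 F K) c₀ W₂) (Vb : ℝ), (∀ y, ‖WL2.equiv ℂ _ W₂ v y‖ ≤ Vb) → ∀ y, ‖WL2.equiv ℂ _ W₂ (T (c v)) y‖ ≤ Csrc * Vb)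
    {Bv : ℝ} (hGsup : ∀ (f : SiteL2K ℂ 3 (periodsT3 F K) c₀ W₂) (Fb : ℝ), (∀ y, ‖WL2.equiv ℂ _ W₂ f y‖ ≤ Fb) → ∀ y, ‖WL2.equiv ℂ _ W₂ (G f) y‖ ≤ Bv * Fb)
    (v : Site (F.P K) 0 → Matrix (Fin 2) (Fin 2) ℂ) {m : ℝ} (hv : ∀ x, ‖v x‖ ≤ m) (x : Site (F.P K) 0) :
    ‖(toL2S F K c₀).symm (GprimeP F n K h c₀ cB a' U₀ (RS F n K h c₀ cB U₀ (toL2S F K c₀ v))) x‖ ≤ Real.sqrt 2 * (Bv * (1 + Bv * Csrc)) * m := by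
  rw [toL2S_symm_apply]
  refine (norm_frobEquiv_le _).trans ?_
  calc ‖WL2.equiv ℂ _ W₂ (GprimeP F n K h c₀ cB a' U₀ (RS F n K h c₀ cB U₀ (toL2S F K c₀ v))) (siteEquiv F K x)‖
      ≤ Bv * (1 + Bv * Csrc) * (Real.sqrt 2 * m) :=
        norm_equiv_GprimeP_RS_le_of_letters F h U₀ Q'' hseq ι T G hGA hRS hker ha' c hsrcid hsrc hGsup (toL2S F K c₀ v) (Real.sqrt 2 * m)
          (norm_equiv_toL2S_le_sqrt_two_mul F v hv) _
    _ = Real.sqrt 2 * (Bv * (1 + Bv * Csrc)) * m := by ring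

include hseq hGA hRS hker in
omit [Fact (0 < c₁)] in
/-- ★ **(c2ʳ) = FILE C's (c2): `‖toL2⁻¹(D_{U₀}(G′ᴾ_{a′}(R_S(toL2S v)))) b‖ ≤ √2·R₁(1 + B_∞C_src)·m`** whenever `‖v x‖ ≤ m` for all `x` ((c3) read through the dictionary).
[cite: Balaban1985BackgroundPropagators, (3.21)–(3.25) p.394, Thm 3.1 (3.42)∕(3.46) pp.397–398; Balaban1985Variational, (139) p.299] -/
theorem norm_symm_DL2_GprimeP_RS_toL2S_le_of_letters {a' : ℝ} (ha' : 0 ≤ a') (c : SiteL2K ℂ 3 (periodsT3 F K) c₀ W₂ → SiteL2K ℂ 3 (periodsT3 F n) c₁ W₂)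
    (hsrcid : ∀ v, v - projR (covLapSite F n K c₀ U₀) Q'' v = G (T (c v)))
    {Csrc : ℝ} (hsrc : ∀ (v : SiteL2K ℂ 3 (periodsT3 F K) c₀ W₂) (Vb : ℝ), (∀ y, ‖WL2.equiv ℂ _ W₂ v y‖ ≤ Vb) → ∀ y, ‖WL2.equiv ℂ _ W₂ (T (c v)) y‖ ≤ Csrc * Vb)
    {Bv : ℝ} (hGsup : ∀ (f : SiteL2K ℂ 3 (periodsT3 F K) c₀ W₂) (Fb : ℝ), (∀ y, ‖WL2.equiv ℂ _ W₂ f y‖ ≤ Fb) → ∀ y, ‖WL2.equiv ℂ _ W₂ (G f) y‖ ≤ Bv * Fb)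
    {R₁ : ℝ} (hT1 : ∀ (f : SiteL2K ℂ 3 (periodsT3 F K) c₀ W₂) (Fb : ℝ), (∀ y, ‖WL2.equiv ℂ _ W₂ f y‖ ≤ Fb) →
      ∀ p : Bond 3 (periodsT3 F K), ‖WL2.equiv ℂ _ W₂ (DL2 F n K c₀ U₀ (G f)) p‖ ≤ R₁ * Fb)
    (v : Site (F.P K) 0 → Matrix (Fin 2) (Fin 2) ℂ) {m : ℝ} (hv : ∀ x, ‖v x‖ ≤ m) (b : PBond (F.P K) 0) :
    ‖(toL2 F K c₀).symm (DL2 F n K c₀ U₀ (GprimeP F n K h c₀ cB a' U₀ (RS F n K h c₀ cB U₀ (toL2S F K c₀ v)))) b‖ ≤ Real.sqrt 2 * (R₁ * (1 + Bv * Csrc)) * m := by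
  rw [toL2_symm_apply]
  refine (norm_frobEquiv_le _).trans ?_
  calc ‖WL2.equiv ℂ _ W₂ (DL2 F n K c₀ U₀ (GprimeP F n K h c₀ cB a' U₀ (RS F n K h c₀ cB U₀ (toL2S F K c₀ v)))) (bondEquiv F K b)‖
      ≤ R₁ * (1 + Bv * Csrc) * (Real.sqrt 2 * m) :=
        norm_equiv_DL2_GprimeP_RS_le_of_letters F h U₀ Q'' hseq ι T G hGA hRS hker ha' c hsrcid hsrc hGsup hT1 (toL2S F K c₀ v) (Real.sqrt 2 * m)
          (norm_equiv_toL2S_le_sqrt_two_mul F v hv) _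
    _ = Real.sqrt 2 * (R₁ * (1 + Bv * Csrc)) * m := by ring

include hseq hT hAG hGA hRS hker in
/-- ★ **(c3ʳ) = FILE C's (c3): `‖toL2S⁻¹(R_S(G′ᴾ_{a′}(toL2S v))) x‖ ≤ √2·B_∞(1 + C_srcB_∞)·m`** whenever `‖v x‖ ≤ m` for all `x` ((c4) read through the dictionary).
[cite: Balaban1985BackgroundPropagators, (3.21)–(3.25) p.394, Thm 3.1 (3.42)∕(3.46) pp.397–398; Balaban1985Variational, (139) p.299] -/
theorem norm_symm_RS_GprimeP_toL2S_le_of_letters {a' : ℝ} (ha' : 0 ≤ a') (c : SiteL2K ℂ 3 (periodsT3 F K) c₀ W₂ → SiteL2K ℂ 3 (periodsT3 F n) c₁ W₂)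
    (hsrcid : ∀ v, v - projR (covLapSite F n K c₀ U₀) Q'' v = G (T (c v)))
    {Csrc : ℝ} (hsrc : ∀ (v : SiteL2K ℂ 3 (periodsT3 F K) c₀ W₂) (Vb : ℝ), (∀ y, ‖WL2.equiv ℂ _ W₂ v y‖ ≤ Vb) → ∀ y, ‖WL2.equiv ℂ _ W₂ (T (c v)) y‖ ≤ Csrc * Vb)
    {Bv : ℝ} (hGsup : ∀ (f : SiteL2K ℂ 3 (periodsT3 F K) c₀ W₂) (Fb : ℝ), (∀ y, ‖WL2.equiv ℂ _ W₂ f y‖ ≤ Fb) → ∀ y, ‖WL2.equiv ℂ _ W₂ (G f) y‖ ≤ Bv * Fb)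
    (v : Site (F.P K) 0 → Matrix (Fin 2) (Fin 2) ℂ) {m : ℝ} (hv : ∀ x, ‖v x‖ ≤ m) (x : Site (F.P K) 0) :
    ‖(toL2S F K c₀).symm (RS F n K h c₀ cB U₀ (GprimeP F n K h c₀ cB a' U₀ (toL2S F K c₀ v))) x‖ ≤ Real.sqrt 2 * (Bv * (1 + Csrc * Bv)) * m := by
  rw [toL2S_symm_apply]
  refine (norm_frobEquiv_le _).trans ?_
  calc ‖WL2.equiv ℂ _ W₂ (RS F n K h c₀ cB U₀ (GprimeP F n K h c₀ cB a' U₀ (toL2S F K c₀ v))) (siteEquiv F K x)‖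
      ≤ Bv * (1 + Csrc * Bv) * (Real.sqrt 2 * m) :=
        norm_equiv_RS_GprimeP_le_of_letters F h U₀ Q'' hseq ι T hT G hAG hGA hRS hker ha' c hsrcid hsrc hGsup (toL2S F K c₀ v) (Real.sqrt 2 * m)
          (norm_equiv_toL2S_le_sqrt_two_mul F v hv) _
    _ = Real.sqrt 2 * (Bv * (1 + Csrc * Bv)) * m := by ring

end Summit.QuantumFields.YangMills.Theorems.Prop7GaugeProjectorSupPackage

end
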